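import Literature.AnabelianGeometry.AbsoluteAnabelian.MLFSlimKummerProofs
import Literature.AnabelianGeometry.AbsoluteAnabelian.AbsTopIII.KummerFaithfulProofs
import Mathlib.NumberTheory.NumberField.Basic
import HarnessLib

/-!
# [AbsAnab] Thm 1.1.1 (ii), global half — `G_F` is slim for a number field `F`: an UNCONDITIONAL
# proof (Kummer theory; neither [NSW] Cor. 12.1.3 nor class field theory)

S. Mochizuki, *The Absolute Anabelian Geometry of Hyperbolic Curves* (2004) [AbsAnab], Thm 1.1.1
(ii) p. 6, "in particular": the absolute Galois group `G_F` of a number field `F` is slim.  The tree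
types this as the named fact `galoisNF_slim` (`MLFGaloisGroups.lean`, abc-iut-L4-t4); the printed
deduction (from Thm 1.1.1 (i), commensurable terminality of decomposition groups [NSW 12.1.3], and
the relative slimness of `G_𝔭 ↪ G_F`) is kernel-checked CONDITIONALLY in `NFGaloisGroupsProofs.lean`
(abc-iut-L4-t11, `galoisNF_slim_of_relativelySlim`).  THIS file proves `galoisNF_slim` OUTRIGHT
(`galoisNF_slim_holds`) by the Kummer argument of `MLFSlimKummerProofs.lean`
(`exists_int_forall_sigma_eq`: `σ(a) = βⁿ · a^m` for `a` in a finite subextension `M ⊇ E₀ ∋ x`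
over which `σ` centralises the Galois group):

* the exponent `m` is pinned down by `σ(2) = 2`: embedding the number field `M` into a FINITE
  extension `E` of `ℚ_2` (`exists_ringHom_finite_padic`; `IsAlgClosed.lift`), the spectral exponent
  `‖·‖^{[E:ℚ_2]!} = 2^{e(·)}` of `PadicEmbeddingRigidity.lean` turns `2^{1−m} = βⁿ` with `n = N·[E:ℚ_2]!`
  into `N ∣ m − 1`;
* hence `σ(x)/x ∈ ⋂_N (M^×)^N`, which is `{1}` because number fields are torally Kummer-faithful
  ([AbsTopIII] Rmk 1.5.3 (i) = `isTorallyKummerFaithful_of_numberField`, abc-iut-L4-t16).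

Proof-only: no definitions.  HONEST FRAMING: a classical theorem (slimness of `G_F`) with a proof
free of unformalised inputs; nothing here bears on [IUTchIII] Cor. 3.12.
[cite: MochizukiAbsAnab2004, Thm 1.1.1 (ii) p.6]
-/

noncomputable section

open scoped Classical IntermediateField

namespace Literature.AnabelianGeometry.AbsoluteAnabelian

open Field IntermediateField
open Literature.AlgebraicGeometry.Frobenioids (IsSlimGroup)
open AbsTopIII

/-- Every field `M` finite over `ℚ` (a number field) maps into a finite extension of `ℚ_2` inside
`ℚ̄_2`. [cite: MochizukiAbsAnab2004, Thm 1.1.1 (ii) p.6] -/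
private theorem exists_ringHom_finite_padic (M : Type) [Field M] [Algebra ℚ M] [Module.Finite ℚ M] :
    ∃ E : IntermediateField ℚ_[2] (AlgebraicClosure ℚ_[2]),
      FiniteDimensional ℚ_[2] E ∧ Nonempty (M →+* E) := by
  haveI : Fact (Nat.Prime 2) := ⟨Nat.prime_two⟩
  haveI : Algebra.IsAlgebraic ℚ M := Algebra.IsAlgebraic.of_finite ℚ M
  let Ω₂ : Type := AlgebraicClosure ℚ_[2]
  let ψ : M →ₐ[ℚ] Ω₂ := IsAlgClosed.lift
  let b := Module.Free.chooseBasis ℚ M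
  let s : Finset Ω₂ := (Finset.univ : Finset (Module.Free.ChooseBasisIndex ℚ M)).image fun i => ψ (b i)
  let E : IntermediateField ℚ_[2] Ω₂ := IntermediateField.adjoin ℚ_[2] (s : Set Ω₂)
  have hψ : ∀ x : M, ψ x ∈ E := by
    intro x
    rw [← b.sum_repr x, map_sum]
    refine sum_mem fun i _ => ?_
    rw [map_smul, Rat.smul_def, ← map_ratCast (algebraMap ℚ_[2] Ω₂)]
    refine mul_mem (E.algebraMap_mem _) (IntermediateField.subset_adjoin ℚ_[2] _ ?_)
    simp [s]
  haveI : FiniteDimensional ℚ_[2] E := by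
    refine IntermediateField.finiteDimensional_adjoin (S := (s : Set Ω₂)) fun x _ => ?_
    exact Algebra.IsIntegral.isIntegral x
  exact ⟨E, inferInstance, ⟨(ψ : M →+* Ω₂).codRestrict E hψ⟩⟩

/-- **[AbsAnab] Thm 1.1.1 (ii), global half — DISCHARGED unconditionally**: the absolute Galois
group of a number field is slim.  Kummer theory (`exists_int_forall_sigma_eq`), the `2`-adic
spectral exponent through an embedding of a number field into a finite extension of `ℚ_2`, and the
toral Kummer-faithfulness of number fields. [cite: MochizukiAbsAnab2004, Thm 1.1.1 (ii) p.6] -/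
theorem galoisNF_slim_holds : galoisNF_slim := by
  intro F _ _
  haveI : Fact (Nat.Prime 2) := ⟨Nat.prime_two⟩
  have h21 : (1 : ℝ) < 2 := by norm_num
  have h20 : (0 : ℝ) < 2 := by norm_num
  haveI : Algebra.IsAlgebraic F (AlgebraicClosure F) := AlgebraicClosure.isAlgebraic F
  refine ⟨fun U hU => ?_⟩
  rw [eq_bot_iff]
  intro σ hσ
  rw [Subgroup.mem_centralizer_iff] at hσ
  rw [Subgroup.mem_bot]
  set σ' : (AlgebraicClosure F) ≃ₐ[F] (AlgebraicClosure F) :=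
    absoluteGaloisGroup.toAlgEquiv F σ with hσ'
  suffices hfix : ∀ x : AlgebraicClosure F, σ' x = x by
    apply (absoluteGaloisGroup.toAlgEquiv F).injective
    rw [map_one]
    exact AlgEquiv.ext hfix
  obtain ⟨E₀, hE₀fin, -, hE₀U⟩ := exists_intermediateField_of_isOpen_absoluteGaloisGroup F U hU
  haveI := hE₀fin
  intro x
  by_cases hx0 : x = 0
  · rw [hx0, map_zero]
  haveI : FiniteDimensional F F⟮x⟯ :=
    IntermediateField.adjoin.finiteDimensional (Algebra.IsIntegral.isIntegral x)
  set M : IntermediateField F (AlgebraicClosure F) := E₀ ⊔ F⟮x⟯ with hMdef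
  haveI : FiniteDimensional F M := IntermediateField.finiteDimensional_sup E₀ F⟮x⟯
  have hxM : x ∈ M := (le_sup_right : F⟮x⟯ ≤ M) (IntermediateField.mem_adjoin_simple_self F x)
  have hcomm : ∀ τ ∈ M.fixingSubgroup, ∀ y : AlgebraicClosure F, τ (σ' y) = σ' (τ y) := by
    intro τ hτ y
    have hτE₀ : τ ∈ E₀.fixingSubgroup := by
      rw [IntermediateField.mem_fixingSubgroup_iff] at hτ ⊢
      exact fun z hz => hτ z ((le_sup_left : E₀ ≤ M) hz)
    have hτU : (absoluteGaloisGroup.toAlgEquiv F).symm τ ∈ U := by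
      rw [← hE₀U]
      exact hτE₀
    have h := hσ _ hτU
    have h' := congrArg (fun g => absoluteGaloisGroup.toAlgEquiv F g y) h
    simpa [hσ', AlgEquiv.mul_apply] using h'
  have hσxM : σ' x ∈ M := by
    rw [← InfiniteGalois.fixedField_fixingSubgroup M, IntermediateField.mem_fixedField_iff]
    intro τ hτ
    rw [hcomm τ hτ x, (IntermediateField.mem_fixingSubgroup_iff _ _).mp hτ x hxM]
  -- `M` is a number field; embed it into a finite extension `E` of `ℚ_2`
  haveI : IsScalarTower ℚ F M := IsScalarTower.of_algebraMap_eq fun q => by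
    simp only [eq_ratCast, map_ratCast]
  haveI : Module.Finite ℚ M := Module.Finite.trans F M
  obtain ⟨E, hEfin, ⟨ψ⟩⟩ := exists_ringHom_finite_padic M
  haveI := hEfin
  haveI : Algebra.IsAlgebraic ℚ_[2] E := Algebra.IsAlgebraic.of_finite ℚ_[2] E
  set D : ℕ := (Module.finrank ℚ_[2] E).factorial with hD
  have hD0 : D ≠ 0 := Nat.factorial_ne_zero _
  -- exponents through `ψ`: for `z ∈ M`, `z ≠ 0`: `‖ψ z‖^D = 2^e`
  have hexp : ∀ z : M, z ≠ 0 → ∃ e : ℤ, spectralNorm ℚ_[2] E (ψ z) ^ D = (2 : ℝ) ^ e := by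
    intro z hz
    obtain ⟨e, he⟩ := exists_spectralNorm_pow_factorial_eq_zpow 2 E (ψ z) ((map_ne_zero ψ).mpr hz)
    exact ⟨e, by rw [hD]; exact_mod_cast he⟩
  -- the unit `u := σ x / x` of `M`
  set xM : M := ⟨x, hxM⟩ with hxMdef
  set sxM : M := ⟨σ' x, hσxM⟩ with hsxMdef
  have hσx0 : σ' x ≠ 0 := (map_ne_zero σ').mpr hx0
  have hxM0 : xM ≠ 0 := fun h => hx0 (congrArg Subtype.val h)
  have hsxM0 : sxM ≠ 0 := fun h => hσx0 (congrArg Subtype.val h)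
  set u : Mˣ := Units.mk0 sxM hsxM0 / Units.mk0 xM hxM0 with hudef
  have hdiv : ∀ N : ℕ, 0 < N → ∃ c : Mˣ, c ^ N = u := by
    intro N hN
    have hn : 0 < N * D := Nat.mul_pos hN (Nat.pos_of_ne_zero hD0)
    obtain ⟨m, hm⟩ := exists_int_forall_sigma_eq M σ' hcomm hn
    -- `σ 2 = 2` pins down `m` modulo `N`
    have h2M : (2 : AlgebraicClosure F) ∈ M := by
      have := _root_.natCast_mem M 2
      exact_mod_cast this
    have h20' : (2 : AlgebraicClosure F) ≠ 0 := two_ne_zero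
    obtain ⟨β, hβM, hβ0, hσ2⟩ := hm 2 h2M h20'
    rw [map_ofNat] at hσ2
    set βM : M := ⟨β, hβM⟩ with hβMdef
    have hβM0 : βM ≠ 0 := fun h => hβ0 (congrArg Subtype.val h)
    -- the same identity inside `M`: `2 = βM^(N D) * 2^m`
    have hβeq : (2 : M) = βM ^ (N * D) * (2 : M) ^ m := by
      apply (algebraMap M (AlgebraicClosure F)).injective
      rw [map_mul, map_pow, map_zpow₀, map_ofNat]
      exact hσ2
    -- apply `ψ` and take `2`-adic spectral norms in `E`
    obtain ⟨eβ, heβ⟩ := hexp βM hβM0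
    have hm1 : m = 1 + N * eβ := by
      -- the multiplicative spectral norm of `E/ℚ_2` (bundled, to stay clear of instance paths)
      set f := spectralMulAlgNorm ℚ_[2] E with hfdef
      have hf : ∀ z : E, f z = spectralNorm ℚ_[2] E z := fun _ => rfl
      have h2E : f (2 : E) = (2 : ℝ) ^ (-1 : ℤ) := by
        rw [hf, ← map_ofNat (algebraMap ℚ_[2] E) 2, spectralNorm_extends, zpow_neg, zpow_one]
        exact_mod_cast Padic.norm_p (p := 2)
      have hψ : (2 : E) = ψ βM ^ (N * D) * (2 : E) ^ m := by
        have := congrArg ψ hβeq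
        rwa [map_mul, map_pow, map_zpow₀, map_ofNat] at this
      have hψ' : f (2 : E) = f (ψ βM) ^ (N * D) * f (2 : E) ^ m := by
        conv_lhs => rw [hψ]
        rw [map_mul, map_pow, map_zpow₀]
      have hr : f (ψ βM) ^ (N * D) = (2 : ℝ) ^ (eβ * N) := by
        rw [mul_comm N D, pow_mul, hf, heβ, ← zpow_natCast, ← zpow_mul]
      rw [hr, h2E, ← zpow_mul, ← zpow_add₀ h20.ne'] at hψ'
      have := zpow_right_injective₀ h20 h21.ne' hψ'
      linarith
    -- Step 1 for `a = x`
    obtain ⟨β', hβ'M, hβ'0, hσxeq⟩ := hm x hxM hx0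
    have hc0 : (⟨β' ^ D * x ^ eβ, mul_mem (pow_mem hβ'M D) (zpow_mem hxM eβ)⟩ : M) ≠ 0 := by
      intro h
      have := congrArg Subtype.val h
      exact mul_ne_zero (pow_ne_zero _ hβ'0) (zpow_ne_zero _ hx0) this
    refine ⟨Units.mk0 _ hc0, ?_⟩
    apply Units.ext
    apply Subtype.ext
    change (β' ^ D * x ^ eβ) ^ N = σ' x / x
    rw [hσxeq, hm1, eq_div_iff hx0, mul_pow, ← pow_mul, mul_comm D N, ← zpow_natCast (x ^ eβ),
      ← zpow_mul]
    rw [show x ^ (1 + (N : ℤ) * eβ) = x * x ^ (eβ * (N : ℤ)) by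
      rw [← zpow_one_add₀ hx0]; ring_nf]
    ring
  have hu1 : u = 1 :=
    ((isTorallyKummerFaithful_of_numberField F).units M inferInstance).eq_one_of_forall_exists_pow
      u hdiv
  have := congrArg (fun v : Mˣ => ((v : M) : AlgebraicClosure F)) hu1
  simp only [hudef, Units.val_div_eq_div_val, Units.val_mk0, Units.val_one] at this
  have hval : ((sxM / xM : M) : AlgebraicClosure F) = σ' x / x := rfl
  rw [hval] at this
  simpa [div_eq_one_iff_eq hx0] using this

end Literature.AnabelianGeometry.AbsoluteAnabelian
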